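import Literature.NumberTheory.EllipticCurves.IwasawaTwistModPk
import Literature.NumberTheory.EllipticCurves.IwasawaTwistModPShapiroConj
import HarnessLib

/-!
# The `T`-adic tower `(H¹(K, 𝒯_J^{(k)}))_J` of the mod-`(p^k, T^J)` Iwasawa twists, and the level-`p^k`
# inverse Shapiro maps `H¹(K_n, M) → H¹(K, 𝒯_J^{(k)})` (`J ≤ p^{n+1−k}`) — definitions + proofs; no fact

Topic `NumberTheory/EllipticCurves` (sequel of `IwasawaTwistModPk`; level-`p^k` twin of
`IwasawaTwistModPTower` + `IwasawaTwistModPShapiroCores`; imports `…ShapiroConj` only for the general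
`cohomologyMap_cores`); namespace
`Literature.NumberTheory.EllipticCurves.ZpExtension`.  Cell `bsd-f3-mu` (crux `KatoDivisibilityX9` =
item stmt-BirchSwinnertonDyer-20547, line `graded_euler_loss`, stub `stub_depthX9`), typing ask
**T-es-6 (c)** part 1 (definition item `defn-IwasawaH1.redTowerPk`; part 2 =
`Kato2004/IwasawaH1ReductionTowerPk.lean`, the reduction `𝐇¹_Γ(T_pW) → lim←_J H¹(ℚ, 𝒯_J^{(k)}(E))` and
its compatibility with the mod-`p` `redTower`).  DEFINITIONS WITH BODIES AND PROVED THEOREMS ONLY —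
nothing is asserted (D-0026); no instance, no notation.

For a field `K`, `κ : ZpExtension K p` (`Γ_n = κ.layerSubgroup n`), `ρ : DiscreteGaloisModule K M` with
`hM : ∀ x, p^k • x = 0`, `𝒯_J^{(k)} := κ.twistModPk ρ hM J = M ⊗ (ℤ/p^k)[T]/(T^J)(χ_κ)`:

* §0 (general `H¹` helpers, namespace `…GaloisRepresentations`): `galoisCohomology.map` on classes
  along any continuous equivariant map of discrete modules (`map_oneCocycleClass_ofHom`,
  `map_congr_apply`, `map_eq_zero_of_apply_eq_zero`, `map_map_of_comp_apply`); the naturality of the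
  tree's corestriction `cores` in the coefficients is the tree's `cohomologyMap_cores`
  (`IwasawaTwistModPShapiroConj`), that of `coresLe` is `cohomologyMap_coresLe` (`…ShapiroCores`).
* §1 `twistModPkShift`, `shiftH1Pk J` (= `T` on `H¹(K, 𝒯_J^{(k)})`), `truncH1Pk h` (`J' ≤ J`),
  `shiftH1Pk_iterate_eq_zero` (`T^[J] = 0`), `truncH1Pk_shiftH1Pk`, `truncH1Pk_truncH1Pk`, `truncH1Pk_refl`.
* §2 **`twistTowerPk ρ hM`** `:= lim←_J H¹(K, 𝒯_J^{(k)})` (compatible families, an `AddSubgroup` of the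
  product — the SAME construction as `twistTower` over `twistModPk`), `mem_twistTowerPk_iff`,
  `towerShiftPk` (+ iterates), separatedness `eq_zero_of_forall_exists_iterate_pk`, `ord_T`
  (`exists_iterate_eq_and_not_mem_range_pk`), `towerConstPk` (reduction mod `T`) and
  `towerConstPk_towerShiftPk`.
* §3 **The level-`p^k` inverse Shapiro maps.**  `unitCoeffPk J : M →+ 𝒯_J^{(k)}`, `m ↦ m·T⁰`, is
  `Γ_n`-equivariant as soon as `J ≤ p^{n+1−k}` (`Γ_n` then acts through `ρ`,
  `twistModPk_apply_of_mem_layerSubgroup`); **`coresShapiroPk n J h := cor_{Γ_n}^{Γ_K} ∘ H¹(unitCoeffPk J) :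
  H¹(Γ_n, M) → H¹(Γ_K, 𝒯_J^{(k)})`** (Serre's formula for the corestriction through the induced module;
  at level `p^k` the `T`-adic quotient `(ℤ/p^k)[T]/(T^J)` of `(ℤ/p^k)[Γ_K/Γ_n] = (ℤ/p^k)[T]/(ω_n)` is a
  genuine quotient, `ω_n = (1+T)^{p^n} − 1 ∈ (p^k, T^J)` iff `J ≤ p^{n+1−k}`, so NO bijectivity is
  claimed, unlike the mod-`p` `coresShapiro`).  Dictionary: `truncH1Pk_coresShapiroPk` (truncation in
  `J`), `coresShapiroPk_eq_of_le` (change of layer `n ≤ n'` along `coresLe`), and the comparison with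
  the MOD-`p` MODEL **`map_toModP_coresShapiroPk`**: along `f : M → M'` into a `p`-torsion module,
  `H¹(twistModPkToModP f) ∘ coresShapiroPk n J = trunc_{J ← p^n} ∘ coresShapiro n ∘ H¹(f|_{Γ_n})`.
* §4 `twistTowerPkToModP f : twistTowerPk ρ hM →+ twistTower ρ' hM'` — the levelwise map of towers
  along a coefficient morphism into the mod-`p` model (`truncH1_map_toModP`).

References: B. Mazur, K. Rubin, *Kolyvagin systems*, Mem. AMS 799 (2004) §5.3 [MazurRubin2004];
J.-P. Serre, *Galois Cohomology* (1997), I §2.2 (functoriality), I §2.4 (corestriction), I §2.5 (b)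
(`Cor` through the induced module) [SerreGaloisCohomology1997]; J. Neukirch, A. Schmidt, K. Wingberg,
*Cohomology of Number Fields* (2008), I §5, (1.6.4)–(1.6.5) [NeukirchSchmidtWingberg2008]; K. Kato,
Astérisque 295 (2004) §13.8 p. 228 [Kato2004Asterisque]; L. Washington, *Introduction to Cyclotomic
Fields*, §13.1–13.2 [Washington1997]; cell bsd-f3-mu MEMO-es §25.3.
-/

noncomputable section

open scoped Topology ContRepresentation
open Field Filter CategoryTheory

universe u w

/-! ## §0 General `H¹` helpers -/

namespace Literature.NumberTheory.GaloisRepresentations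

namespace galoisCohomology

variable {K : Type u} [Field K]
variable {N₁ N₂ N₃ : Type u} [AddCommGroup N₁] [TopologicalSpace N₁] [DiscreteTopology N₁]
  [AddCommGroup N₂] [TopologicalSpace N₂] [DiscreteTopology N₂]
  [AddCommGroup N₃] [TopologicalSpace N₃] [DiscreteTopology N₃]
  {ρ₁ : DiscreteGaloisModule K N₁} {ρ₂ : DiscreteGaloisModule K N₂} {ρ₃ : DiscreteGaloisModule K N₃}

/-- `H¹(f)[φ] = [f ∘ φ]` for a continuous equivariant map of discrete Galois modules (the pullback
cocycle along `(id_{Γ_K}, f)`). [cite: SerreGaloisCohomology1997, I §2.2] -/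
theorem map_oneCocycleClass_ofHom (f : ρ₁.toContRepresentation →ⁱL ρ₂.toContRepresentation)
    (φ : contOneCocycles ρ₁.toTopRep) :
    galoisCohomology.map f 1 (oneCocycleClass ρ₁.toTopRep φ) =
      oneCocycleClass ρ₂.toTopRep
        (contOneCocycles.pullback (ContinuousMonoidHom.id (absoluteGaloisGroup K))
          (X := ρ₁.toTopRep) (Y := ρ₂.toTopRep)
          (TopRep.ofHom ⟨f.toContinuousLinearMap, f.isIntertwining'⟩) φ) :=
  map_oneCocycleClass _ _ _ φ

/-- Two continuous equivariant maps with the same underlying function induce the same map on `H¹`.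
[cite: SerreGaloisCohomology1997, I §2.2] -/
theorem map_congr_apply (f g : ρ₁.toContRepresentation →ⁱL ρ₂.toContRepresentation)
    (hfg : ∀ x, f x = g x) (c : galoisCohomology ρ₁ 1) :
    galoisCohomology.map f 1 c = galoisCohomology.map g 1 c := by
  obtain ⟨φ, rfl⟩ := oneCocycleClass_surjective _ c
  rw [map_oneCocycleClass_ofHom, map_oneCocycleClass_ofHom]
  congr 1
  exact Subtype.ext (ContinuousMap.ext fun σ => hfg _)

/-- If a continuous equivariant map vanishes identically, so does the induced map on `H¹`.
[cite: SerreGaloisCohomology1997, I §2.2] -/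
theorem map_eq_zero_of_apply_eq_zero (f : ρ₁.toContRepresentation →ⁱL ρ₂.toContRepresentation)
    (hf : ∀ x, f x = 0) (c : galoisCohomology ρ₁ 1) : galoisCohomology.map f 1 c = 0 := by
  obtain ⟨φ, rfl⟩ := oneCocycleClass_surjective _ c
  rw [map_oneCocycleClass_ofHom]
  exact (oneCocycleClass_eq_zero_iff _ _).mpr ⟨0, fun σ => by
    rw [contOneCocycles.pullback_apply, map_zero, sub_zero]
    exact hf _⟩

/-- `H¹(g) ∘ H¹(f) = H¹(h)` whenever `h = g ∘ f` on elements (checked on classes).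
[cite: SerreGaloisCohomology1997, I §2.2] -/
theorem map_map_of_comp_apply (f : ρ₁.toContRepresentation →ⁱL ρ₂.toContRepresentation)
    (g : ρ₂.toContRepresentation →ⁱL ρ₃.toContRepresentation)
    (h : ρ₁.toContRepresentation →ⁱL ρ₃.toContRepresentation)
    (hcomp : ∀ x, h x = g (f x)) (c : galoisCohomology ρ₁ 1) :
    galoisCohomology.map g 1 (galoisCohomology.map f 1 c) = galoisCohomology.map h 1 c := by
  obtain ⟨φ, rfl⟩ := oneCocycleClass_surjective _ c
  rw [map_oneCocycleClass_ofHom, map_oneCocycleClass_ofHom, map_oneCocycleClass_ofHom]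
  congr 1
  exact Subtype.ext (ContinuousMap.ext fun σ => (hcomp _).symm)

/-- `galoisCohomology.map f 1` is the tree's `cohomologyMap` of the `TopRep` morphism underlying `f`
(definitionally). [cite: SerreGaloisCohomology1997, I §2.2] -/
theorem map_eq_cohomologyMap_apply (f : ρ₁.toContRepresentation →ⁱL ρ₂.toContRepresentation)
    (c : galoisCohomology ρ₁ 1) :
    galoisCohomology.map f 1 c =
      (cohomologyMap (TopRep.ofHom ⟨f.toContinuousLinearMap, f.isIntertwining'⟩ :
        ρ₁.toTopRep ⟶ ρ₂.toTopRep) 1).hom c := rfl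

end galoisCohomology

end Literature.NumberTheory.GaloisRepresentations

namespace Literature.NumberTheory.EllipticCurves

open Literature.NumberTheory.GaloisRepresentations

namespace ZpExtension

variable {K : Type u} [Field K] {p : ℕ} [Fact p.Prime] (κ : ZpExtension K p)
  {M : Type u} [AddCommGroup M] [TopologicalSpace M] [DiscreteTopology M] {k : ℕ}
  (ρ : DiscreteGaloisModule K M) (hM : ∀ x : M, p ^ k • x = 0) (J : ℕ)

/-- Admissible levels: `J ≤ p^N` as soon as `J ≤ N`; private helper. [folklore] -/
private theorem le_prime_pow_of_le' {J N : ℕ} (h : J ≤ N) : J ≤ p ^ N :=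
  h.trans (Nat.lt_pow_self (Fact.out : p.Prime).one_lt).le

/-! ## §1 The shift `T` and the truncations on `H¹(K, 𝒯_J^{(k)})` -/

/-- **Multiplication by `T` on `𝒯_J^{(k)}`** (the shift `S`) as a continuous `Γ_K`-equivariant map
(`shiftEnd_twistModPk_apply`). [cite: Washington1997, §13.1–§13.2] -/
def twistModPkShift :
    (κ.twistModPk ρ hM J).toContRepresentation →ⁱL (κ.twistModPk ρ hM J).toContRepresentation where
  toContinuousLinearMap :=
    { toFun := shiftEnd M J
      map_add' := map_add _
      map_smul' := fun c x => by rw [map_zsmul, RingHom.id_apply]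
      cont := continuous_of_discreteTopology }
  isIntertwining' g := by
    refine ContinuousLinearMap.ext fun x => ?_
    exact shiftEnd_twistModPk_apply κ ρ hM J g x

/-- Unfolding lemma for `twistModPkShift`. [cite: Washington1997, §13.1–§13.2] -/
@[simp] theorem twistModPkShift_apply (x : Fin J → M) :
    κ.twistModPkShift ρ hM J x = shiftEnd M J x := rfl

/-- **`T` on `H¹(K, 𝒯_J^{(k)})`**: the endomorphism induced by the shift.
[cite: SerreGaloisCohomology1997, I §2.2] -/
def shiftH1Pk : galoisCohomology (κ.twistModPk ρ hM J) 1 →+ galoisCohomology (κ.twistModPk ρ hM J) 1 :=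
  galoisCohomology.map (κ.twistModPkShift ρ hM J) 1

variable {J} in
/-- **Truncation on `H¹`**: `H¹(K, 𝒯_J^{(k)}) → H¹(K, 𝒯_{J'}^{(k)})` for `J' ≤ J` (functoriality along
`twistModPkTruncate`). [cite: SerreGaloisCohomology1997, I §2.2] -/
def truncH1Pk {J' : ℕ} (h : J' ≤ J) :
    galoisCohomology (κ.twistModPk ρ hM J) 1 →+ galoisCohomology (κ.twistModPk ρ hM J') 1 :=
  galoisCohomology.map (κ.twistModPkTruncate ρ hM J h) 1

/-- The cocycle `S^a ∘ φ` with values in `𝒯_J^{(k)}`. [cite: Washington1997, §13.1–§13.2] -/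
def shiftPowCocyclePk (a : ℕ) (φ : contOneCocycles (κ.twistModPk ρ hM J).toTopRep) :
    contOneCocycles (κ.twistModPk ρ hM J).toTopRep :=
  ⟨⟨fun σ => (shiftEnd M J ^ a) (φ.1 σ), continuous_of_discreteTopology.comp φ.1.continuous⟩, by
    intro g h
    change (shiftEnd M J ^ a) (φ.1 (g * h)) =
      (shiftEnd M J ^ a) (φ.1 g) + κ.twistModPk ρ hM J g ((shiftEnd M J ^ a) (φ.1 h))
    rw [φ.2 g h, map_add]
    congr 1
    change (shiftEnd M J ^ a) (κ.twistModPk ρ hM J g (φ.1 h)) = _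
    induction a with
    | zero => rfl
    | succ a ih =>
      simp only [pow_succ', Module.End.mul_apply]
      rw [ih, shiftEnd_twistModPk_apply]⟩

/-- Values of `shiftPowCocyclePk`. [cite: Washington1997, §13.1–§13.2] -/
@[simp] theorem shiftPowCocyclePk_apply (a : ℕ) (φ : contOneCocycles (κ.twistModPk ρ hM J).toTopRep)
    (σ : absoluteGaloisGroup K) :
    (κ.shiftPowCocyclePk ρ hM J a φ).1 σ = (shiftEnd M J ^ a) (φ.1 σ) := rfl

/-- On classes, `T^[a] [φ] = [S^a ∘ φ]`. [cite: Washington1997, §13.1–§13.2] -/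
theorem shiftH1Pk_iterate_oneCocycleClass (a : ℕ) (φ : contOneCocycles (κ.twistModPk ρ hM J).toTopRep) :
    (κ.shiftH1Pk ρ hM J)^[a] (oneCocycleClass _ φ) =
      oneCocycleClass (κ.twistModPk ρ hM J).toTopRep (κ.shiftPowCocyclePk ρ hM J a φ) := by
  induction a with
  | zero =>
    rw [Function.iterate_zero, id_eq]
    exact congrArg _ (Subtype.ext (ContinuousMap.ext fun σ => rfl))
  | succ a ih =>
    rw [Function.iterate_succ_apply', ih, shiftH1Pk, galoisCohomology.map_oneCocycleClass_ofHom]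
    congr 1
    refine Subtype.ext (ContinuousMap.ext fun σ => ?_)
    change κ.twistModPkShift ρ hM J ((shiftEnd M J ^ a) (φ.1 σ)) = (shiftEnd M J ^ (a + 1)) (φ.1 σ)
    rw [twistModPkShift_apply, pow_succ', Module.End.mul_apply]

/-- **`T^[a] = 0` on `H¹(K, 𝒯_J^{(k)})` for `a ≥ J`** (`S^J = 0` on `𝒯_J^{(k)}`).
[cite: Washington1997, §13.1–§13.2] -/
theorem shiftH1Pk_iterate_eq_zero {a : ℕ} (ha : J ≤ a) (c : galoisCohomology (κ.twistModPk ρ hM J) 1) :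
    (κ.shiftH1Pk ρ hM J)^[a] c = 0 := by
  obtain ⟨φ, rfl⟩ := oneCocycleClass_surjective _ c
  rw [shiftH1Pk_iterate_oneCocycleClass]
  refine (oneCocycleClass_eq_zero_iff _ _).mpr ⟨0, fun σ => ?_⟩
  rw [shiftPowCocyclePk_apply, shiftEnd_pow_eq_zero ha, LinearMap.zero_apply, map_zero, sub_zero]

variable {J} in
/-- **`T` commutes with truncation** on `H¹` (`J' ≤ J`). [cite: Washington1997, §13.1–§13.2] -/
theorem truncH1Pk_shiftH1Pk {J' : ℕ} (h : J' ≤ J) (c : galoisCohomology (κ.twistModPk ρ hM J) 1) :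
    κ.truncH1Pk ρ hM h (κ.shiftH1Pk ρ hM J c) = κ.shiftH1Pk ρ hM J' (κ.truncH1Pk ρ hM h c) := by
  unfold truncH1Pk shiftH1Pk
  rw [galoisCohomology.map_map_of_comp_apply _ _
      ((κ.twistModPkTruncate ρ hM J h).comp (κ.twistModPkShift ρ hM J)) (fun _ => rfl),
    galoisCohomology.map_map_of_comp_apply _ _
      ((κ.twistModPkShift ρ hM J').comp (κ.twistModPkTruncate ρ hM J h)) (fun _ => rfl)]
  refine galoisCohomology.map_congr_apply _ _ (fun x => ?_) c
  change κ.twistModPkTruncate ρ hM J h (shiftEnd M J x) = shiftEnd M J' (κ.twistModPkTruncate ρ hM J h x)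
  funext i
  by_cases hi : (i : ℕ) = 0
  · simp [twistModPkTruncate_apply, shiftEnd_apply, hi]
  · simp [twistModPkTruncate_apply, shiftEnd_apply, hi]

variable {J} in
/-- Truncation is transitive on `H¹`. [cite: Washington1997, §13.1–§13.2] -/
theorem truncH1Pk_truncH1Pk {J' J'' : ℕ} (h : J' ≤ J) (h' : J'' ≤ J')
    (c : galoisCohomology (κ.twistModPk ρ hM J) 1) :
    κ.truncH1Pk ρ hM h' (κ.truncH1Pk ρ hM h c) = κ.truncH1Pk ρ hM (h'.trans h) c := by
  unfold truncH1Pk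
  exact galoisCohomology.map_map_of_comp_apply _ _ _ (fun _ => rfl) c

/-- Truncation along `le_refl` is the identity on `H¹`. [cite: Washington1997, §13.1–§13.2] -/
theorem truncH1Pk_refl (c : galoisCohomology (κ.twistModPk ρ hM J) 1) : κ.truncH1Pk ρ hM le_rfl c = c := by
  obtain ⟨φ, rfl⟩ := oneCocycleClass_surjective _ c
  unfold truncH1Pk
  rw [galoisCohomology.map_oneCocycleClass_ofHom]
  exact congrArg _ (Subtype.ext (ContinuousMap.ext fun σ => funext fun i => rfl))

/-! ## §2 The inverse limit `lim←_J H¹(K, 𝒯_J^{(k)})` and its `T`-adic structure -/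

/-- **`lim←_J H¹(K, 𝒯_J^{(k)})`**, the compatible families in `∏_J H¹(K, 𝒯_J^{(k)})` under truncation —
Galois cohomology with `(ℤ/p^k)⟦T⟧`-adic coefficients `M ⊗ Λ/p^k(χ_κ)` written levelwise; the same
`AddSubgroup` as `twistTower`, over `twistModPk`. [cite: MazurRubin2004, §5.3] -/
def twistTowerPk : AddSubgroup (∀ J : ℕ, galoisCohomology (κ.twistModPk ρ hM J) 1) where
  carrier := {x | ∀ (J J' : ℕ) (h : J' ≤ J), κ.truncH1Pk ρ hM h (x J) = x J'}
  zero_mem' := fun J J' h => by simp only [Pi.zero_apply, map_zero]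
  add_mem' := fun {x y} hx hy J J' h => by simp only [Pi.add_apply, map_add, hx J J' h, hy J J' h]
  neg_mem' := fun {x} hx J J' h => by simp only [Pi.neg_apply, map_neg, hx J J' h]

/-- Membership in `twistTowerPk`: compatibility under all truncations. [cite: MazurRubin2004, §5.3] -/
theorem mem_twistTowerPk_iff (x : ∀ J : ℕ, galoisCohomology (κ.twistModPk ρ hM J) 1) :
    x ∈ κ.twistTowerPk ρ hM ↔ ∀ (J J' : ℕ) (h : J' ≤ J), κ.truncH1Pk ρ hM h (x J) = x J' := Iff.rfl

/-- Components of a member of the tower are compatible (coerced form). [cite: MazurRubin2004, §5.3] -/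
theorem truncH1Pk_apply_coe (x : κ.twistTowerPk ρ hM) {J J' : ℕ} (h : J' ≤ J) :
    κ.truncH1Pk ρ hM h (x.1 J) = x.1 J' := x.2 J J' h

/-- **`T` on the tower**: the levelwise shift (it preserves compatible families by
`truncH1Pk_shiftH1Pk`). [cite: MazurRubin2004, §5.3] -/
def towerShiftPk : κ.twistTowerPk ρ hM →+ κ.twistTowerPk ρ hM where
  toFun x := ⟨fun J => κ.shiftH1Pk ρ hM J (x.1 J), fun J J' h => by
    rw [truncH1Pk_shiftH1Pk, x.2 J J' h]⟩
  map_zero' := Subtype.ext (funext fun J => by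
    change κ.shiftH1Pk ρ hM J ((0 : κ.twistTowerPk ρ hM).1 J) = 0
    rw [ZeroMemClass.coe_zero, Pi.zero_apply, map_zero])
  map_add' x y := Subtype.ext (funext fun J => by
    change κ.shiftH1Pk ρ hM J ((x + y).1 J) = κ.shiftH1Pk ρ hM J (x.1 J) + κ.shiftH1Pk ρ hM J (y.1 J)
    rw [AddMemClass.coe_add, Pi.add_apply, map_add])

/-- Components of `towerShiftPk`. [cite: MazurRubin2004, §5.3] -/
@[simp] theorem towerShiftPk_apply_coe (x : κ.twistTowerPk ρ hM) (J : ℕ) :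
    (κ.towerShiftPk ρ hM x).1 J = κ.shiftH1Pk ρ hM J (x.1 J) := rfl

/-- Components of the iterates of `towerShiftPk`. [cite: MazurRubin2004, §5.3] -/
theorem towerShiftPk_iterate_apply_coe (a : ℕ) (x : κ.twistTowerPk ρ hM) (J : ℕ) :
    ((κ.towerShiftPk ρ hM)^[a] x).1 J = (κ.shiftH1Pk ρ hM J)^[a] (x.1 J) := by
  induction a generalizing x with
  | zero => rfl
  | succ a ih => rw [Function.iterate_succ_apply, Function.iterate_succ_apply, ih, towerShiftPk_apply_coe]

/-- **`T`-adic separatedness of the level-`p^k` tower**: a compatible family divisible by every power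
of `T` is zero (at level `J` it lies in `T^[J] H¹(K, 𝒯_J^{(k)}) = 0`). [cite: MazurRubin2004, §5.3] -/
theorem eq_zero_of_forall_exists_iterate_pk (x : κ.twistTowerPk ρ hM)
    (hx : ∀ a : ℕ, ∃ y : κ.twistTowerPk ρ hM, (κ.towerShiftPk ρ hM)^[a] y = x) : x = 0 := by
  refine Subtype.ext (funext fun J => ?_)
  obtain ⟨y, hy⟩ := hx J
  rw [← hy, towerShiftPk_iterate_apply_coe]
  exact κ.shiftH1Pk_iterate_eq_zero ρ hM J le_rfl _

/-- **`ord_T` of a non-zero element of the level-`p^k` tower**: every `x ≠ 0` is `T^[a] y` for some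
`a` and some `y` NOT in the image of `T` (the set of admissible `a` contains `0` and is bounded by any
level `J` with `x_J ≠ 0`; take its maximum).  No freeness is used. [cite: MazurRubin2004, §5.3] -/
theorem exists_iterate_eq_and_not_mem_range_pk {x : κ.twistTowerPk ρ hM} (hx : x ≠ 0) :
    ∃ (a : ℕ) (y : κ.twistTowerPk ρ hM), (κ.towerShiftPk ρ hM)^[a] y = x ∧
      ∀ z : κ.twistTowerPk ρ hM, κ.towerShiftPk ρ hM z ≠ y := by
  classical
  have hJ : ∃ J, x.1 J ≠ 0 := by
    by_contra h
    push Not at h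
    exact hx (Subtype.ext (funext h))
  obtain ⟨J, hJ⟩ := hJ
  let P : ℕ → Prop := fun a => ∃ y : κ.twistTowerPk ρ hM, (κ.towerShiftPk ρ hM)^[a] y = x
  have hbound : ∀ a, P a → a < J := by
    rintro a ⟨y, hy⟩
    by_contra hle
    push Not at hle
    apply hJ
    rw [← hy, towerShiftPk_iterate_apply_coe]
    exact κ.shiftH1Pk_iterate_eq_zero ρ hM J hle _
  have h0 : P 0 := ⟨x, rfl⟩
  have ha : P (Nat.findGreatest P J) := Nat.findGreatest_spec (Nat.zero_le J) h0
  obtain ⟨y, hy⟩ := ha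
  refine ⟨Nat.findGreatest P J, y, hy, fun z hz => ?_⟩
  have hP : P (Nat.findGreatest P J + 1) :=
    ⟨z, by rw [Function.iterate_succ_apply, hz, hy]⟩
  exact Nat.findGreatest_is_greatest (Nat.lt_succ_self _) (hbound _ ⟨y, hy⟩) hP

/-- **Reduction mod `T`** on the level-`p^k` tower, `lim← H¹(K, 𝒯_J^{(k)}) → H¹(K, M)`: the constant
coefficient of the level-`1` component (`twistModPkConstCoeff` at `J = 1`; `𝒯_1^{(k)} = M`).
[cite: MazurRubin2004, §5.3] -/
def towerConstPk : κ.twistTowerPk ρ hM →+ galoisCohomology ρ 1 :=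
  (galoisCohomology.map (κ.twistModPkConstCoeff ρ hM 1 Nat.one_pos) 1).comp
    ((Pi.evalAddMonoidHom (fun J : ℕ => galoisCohomology (κ.twistModPk ρ hM J) 1) 1).comp
      (κ.twistTowerPk ρ hM).subtype)

/-- Unfolding `towerConstPk`. [cite: MazurRubin2004, §5.3] -/
theorem towerConstPk_apply (x : κ.twistTowerPk ρ hM) :
    κ.towerConstPk ρ hM x =
      galoisCohomology.map (κ.twistModPkConstCoeff ρ hM 1 Nat.one_pos) 1 (x.1 1) := rfl

/-- **`T·(tower)` dies modulo `T`**: `towerConstPk (T x) = 0`. [cite: MazurRubin2004, §5.3] -/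
theorem towerConstPk_towerShiftPk (x : κ.twistTowerPk ρ hM) :
    κ.towerConstPk ρ hM (κ.towerShiftPk ρ hM x) = 0 := by
  rw [towerConstPk_apply, towerShiftPk_apply_coe, shiftH1Pk,
    galoisCohomology.map_map_of_comp_apply _ _
      ((κ.twistModPkConstCoeff ρ hM 1 Nat.one_pos).comp (κ.twistModPkShift ρ hM 1)) (fun _ => rfl)]
  refine galoisCohomology.map_eq_zero_of_apply_eq_zero _ (fun y => ?_) _
  change κ.twistModPkConstCoeff ρ hM 1 Nat.one_pos (shiftEnd M 1 y) = 0
  rw [twistModPkConstCoeff_apply, shiftEnd_apply, dif_pos rfl]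

/-! ## §3 The level-`p^k` inverse Shapiro maps `H¹(Γ_n, M) → H¹(Γ_K, 𝒯_J^{(k)})`, `J ≤ p^{n+1−k}` -/

/-- **`M → 𝒯_J^{(k)}`, `m ↦ m · T⁰`** (the vector supported at the coefficient of `T⁰`; for `J = 0` the
zero map into the zero module).  The unit `A → M_G^H(A)`-type map of Shapiro's lemma in the `T`-basis.
[cite: SerreGaloisCohomology1997, I §2.5] -/
def unitCoeffPk (J : ℕ) : M →+ (Fin J → M) where
  toFun m i := if (i : ℕ) = 0 then m else 0
  map_zero' := funext fun i => by simp
  map_add' a b := funext fun i => by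
    by_cases h : (i : ℕ) = 0 <;> simp [h]

omit [TopologicalSpace M] [DiscreteTopology M] in
/-- Unfolding `unitCoeffPk`. [cite: SerreGaloisCohomology1997, I §2.5] -/
theorem unitCoeffPk_apply (m : M) (i : Fin J) :
    unitCoeffPk J m i = if (i : ℕ) = 0 then m else 0 := rfl

omit [TopologicalSpace M] [DiscreteTopology M] in
/-- A coordinatewise map sends `m · T⁰` to `f(m) · T⁰` (any `AddMonoidHomClass`).
[cite: SerreGaloisCohomology1997, I §2.5] -/
theorem map_unitCoeffPk_apply {M' : Type*} [AddCommGroup M'] {Φ : Type*} [FunLike Φ M M']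
    [AddMonoidHomClass Φ M M'] (f : Φ) (m : M) :
    (fun i => f (unitCoeffPk J m i)) = unitCoeffPk J (f m) := by
  funext i
  by_cases h : (i : ℕ) = 0
  · simp [unitCoeffPk_apply, h]
  · simp [unitCoeffPk_apply, h]

omit [TopologicalSpace M] [DiscreteTopology M] in
/-- Truncation `J' ≤ J` sends `m · T⁰ ∈ 𝒯_J` to `m · T⁰ ∈ 𝒯_{J'}`. [cite: Washington1997, §13.1–§13.2] -/
theorem unitCoeffPk_castLE {J' : ℕ} (h : J' ≤ J) (m : M) :
    (fun i : Fin J' => unitCoeffPk J m (Fin.castLE h i)) = unitCoeffPk J' m := by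
  funext i
  simp [unitCoeffPk_apply, Fin.val_castLE]

omit [TopologicalSpace M] [DiscreteTopology M] in
/-- At level `p^n` (with `0 < p^n`) the unit vector is the model's `unitCoeff n m = Pi.single 0 m`.
[cite: SerreGaloisCohomology1997, I §2.5] -/
theorem unitCoeffPk_pow_eq_unitCoeff (n : ℕ) (m : M) : unitCoeffPk (p ^ n) m = unitCoeff n m := by
  funext i
  rw [unitCoeffPk_apply, unitCoeff_apply, Pi.single_apply]
  by_cases h : (i : ℕ) = 0
  · have hi : i = ⟨0, pow_pos (Fact.out : p.Prime).pos n⟩ := Fin.ext h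
    rw [if_pos h, if_pos hi]
  · have hi : i ≠ ⟨0, pow_pos (Fact.out : p.Prime).pos n⟩ := fun hh => h (congrArg Fin.val hh)
    rw [if_neg h, if_neg hi]

variable (n : ℕ)

/-- **`Γ_n` acts on `m · T⁰ ∈ 𝒯_J^{(k)}` through `ρ`** when `J ≤ p^{n+1−k}`: `g · (m T⁰) = (ρ(g) m) T⁰`
for `g ∈ Γ_n` (`(1+T)^{κ(g)} = 1` in `(ℤ/p^k)[T]/(T^J)` on `Γ_n`, `twistModPk_apply_of_mem_layerSubgroup`).
[cite: Washington1997, §13.1–§13.2] -/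
theorem twistModPk_unitCoeffPk_of_mem (h : J ≤ p ^ (n + 1 - k)) {g : absoluteGaloisGroup K}
    (hg : g ∈ κ.layerSubgroup n) (m : M) :
    κ.twistModPk ρ hM J g (unitCoeffPk J m) = unitCoeffPk J (ρ g m) := by
  rw [κ.twistModPk_apply_of_mem_layerSubgroup ρ hM J h hg]
  exact map_unitCoeffPk_apply J (ρ g) m

/-- **`m ↦ m · T⁰` as a morphism `M|_{Γ_n} ⟶ 𝒯_J^{(k)}|_{Γ_n}`** of topological representations of `Γ_n`
(both discrete), for `J ≤ p^{n+1−k}`. [cite: SerreGaloisCohomology1997, I §2.5] -/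
def unitCoeffPkHom (h : J ≤ p ^ (n + 1 - k)) :
    subgroupRep ρ.toTopRep (κ.layerSubgroup n) ⟶
      subgroupRep (κ.twistModPk ρ hM J).toTopRep (κ.layerSubgroup n) :=
  TopRep.ofHom
    ⟨{ toFun := unitCoeffPk J
       map_add' := map_add _
       map_smul' := fun c m ↦ by simp only [map_zsmul, RingHom.id_apply]
       cont := continuous_of_discreteTopology },
      fun g ↦ ContinuousLinearMap.ext fun m ↦
        (κ.twistModPk_unitCoeffPk_of_mem ρ hM J n h g.2 m).symm⟩

/-- `unitCoeffPkHom` is `unitCoeffPk` on elements. [cite: SerreGaloisCohomology1997, I §2.5] -/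
@[simp] theorem unitCoeffPkHom_hom_apply (h : J ≤ p ^ (n + 1 - k)) (m : M) :
    (κ.unitCoeffPkHom ρ hM J n h).hom m = unitCoeffPk J m := rfl

/-- **The level-`p^k` inverse Shapiro map `coresShapiroPk n J : H¹(Γ_n, M) → H¹(Γ_K, 𝒯_J^{(k)})`,
`c ↦ cor_{Γ_n}^{Γ_K}(H¹(m ↦ m T⁰)(c))`** for `J ≤ p^{n+1−k}` — Serre's formula for the corestriction
through the induced module `M ⊗ (ℤ/p^k)[Γ_K/Γ_n]`, followed by the quotient
`(ℤ/p^k)[Γ_K/Γ_n] = (ℤ/p^k)[T]/(ω_n) ↠ (ℤ/p^k)[T]/(T^J)` (`ω_n = (1+T)^{p^n} − 1 ∈ (p^k, T^J)` exactly when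
`J ≤ p^{n+1−k}`).  For `k = 1`, `J = p^n` this is the model's bijective `coresShapiro n`; in general no
bijectivity is claimed.  The finiteness of `Γ_K ⧸ Γ_n` is an instance binder (supply
`haveI := κ.fintypeQuotientLayer n`). [cite: SerreGaloisCohomology1997, I §2.5 Prop. 10 and (b)]
[cite: Kato2004Asterisque, §13.8 (p. 228)] -/
def coresShapiroPk (h : J ≤ p ^ (n + 1 - k)) [Fintype (absoluteGaloisGroup K ⧸ κ.layerSubgroup n)] :
    continuousCohomology 1 (subgroupRep ρ.toTopRep (κ.layerSubgroup n)) →+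
      galoisCohomology (κ.twistModPk ρ hM J) 1 :=
  (cores (κ.twistModPk ρ hM J).toTopRep (κ.layerSubgroup n)
      (κ.isOpen_layerSubgroup n)).toAddMonoidHom.comp
    (cohomologyMap (κ.unitCoeffPkHom ρ hM J n h) 1).hom.toLinearMap.toAddMonoidHom

/-- Unfolding `coresShapiroPk`: `cores ∘ H¹(unitCoeffPkHom)`. [cite: SerreGaloisCohomology1997, I §2.5 (b)] -/
theorem coresShapiroPk_apply (h : J ≤ p ^ (n + 1 - k)) [Fintype (absoluteGaloisGroup K ⧸ κ.layerSubgroup n)]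
    (c : continuousCohomology 1 (subgroupRep ρ.toTopRep (κ.layerSubgroup n))) :
    κ.coresShapiroPk ρ hM J n h c =
      cores (κ.twistModPk ρ hM J).toTopRep (κ.layerSubgroup n) (κ.isOpen_layerSubgroup n)
        (cohomologyMap (κ.unitCoeffPkHom ρ hM J n h) 1 c) := rfl

/-- **Truncation in `J`**: for `J' ≤ J` (both admissible for `Γ_n`),
`trunc_{J' ← J} ∘ coresShapiroPk n J = coresShapiroPk n J'` — naturality of `cores` in the coefficients
(`cohomologyMap_cores`) and `trunc(m T⁰) = m T⁰`. [cite: SerreGaloisCohomology1997, I §2.5 (b)] -/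
theorem truncH1Pk_coresShapiroPk {J' : ℕ} (hJ' : J' ≤ J) (h : J ≤ p ^ (n + 1 - k))
    (h' : J' ≤ p ^ (n + 1 - k)) [Fintype (absoluteGaloisGroup K ⧸ κ.layerSubgroup n)]
    (c : continuousCohomology 1 (subgroupRep ρ.toTopRep (κ.layerSubgroup n))) :
    κ.truncH1Pk ρ hM hJ' (κ.coresShapiroPk ρ hM J n h c) = κ.coresShapiroPk ρ hM J' n h' c := by
  rw [coresShapiroPk_apply, coresShapiroPk_apply, truncH1Pk, galoisCohomology.map_eq_cohomologyMap_apply,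
    cohomologyMap_cores _ (κ.layerSubgroup n) (κ.isOpen_layerSubgroup n)]
  congr 1
  obtain ⟨φ, rfl⟩ := oneCocycleClass_surjective _ c
  rw [cohomologyMap_oneCocycleClass, cohomologyMap_oneCocycleClass, cohomologyMap_oneCocycleClass]
  refine congrArg _ (Subtype.ext (ContinuousMap.ext fun g ↦ ?_))
  rw [pullback_id_resIdHom_apply, pullback_id_resIdHom_apply, pullback_id_resIdHom_apply,
    subgroupRepHom_hom_apply, unitCoeffPkHom_hom_apply, unitCoeffPkHom_hom_apply]
  exact unitCoeffPk_castLE J hJ' _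

/-- **Change of layer `n ≤ n'`**: for `J` admissible for `Γ_n` (hence for `Γ_{n'}`),
`coresShapiroPk n' J c = coresShapiroPk n J (cor_{Γ_{n'} → Γ_n} c)` — transitivity of the transfer
(`cores_coresLe_eq_cores`) and naturality of `coresLe` in the coefficients (`cohomologyMap_coresLe`).
All finiteness structures are instance binders. [cite: SerreGaloisCohomology1997, I §2.5 (b)]
[cite: Kato2004Asterisque, §12.2 (p. 220)] -/
theorem coresShapiroPk_eq_of_le {n n' : ℕ} (hn : n ≤ n') (h : J ≤ p ^ (n + 1 - k))
    (h' : J ≤ p ^ (n' + 1 - k))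
    [Fintype (absoluteGaloisGroup K ⧸ κ.layerSubgroup n)]
    [Fintype (absoluteGaloisGroup K ⧸ κ.layerSubgroup n')]
    [Fintype (κ.layerSubgroup n ⧸ (κ.layerSubgroup n').subgroupOf (κ.layerSubgroup n))]
    (c : continuousCohomology 1 (subgroupRep ρ.toTopRep (κ.layerSubgroup n'))) :
    κ.coresShapiroPk ρ hM J n' h' c =
      κ.coresShapiroPk ρ hM J n h
        (coresLe ρ.toTopRep (κ.layerSubgroup_antitone hn) (κ.isOpen_layerSubgroup n') c) := by
  obtain ⟨φ, rfl⟩ := oneCocycleClass_surjective _ c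
  have hφ : contOneCocycles.pullback (ContinuousMonoidHom.id _)
        (resIdHom (restrictHomOfLe (X := ρ.toTopRep) (Y := (κ.twistModPk ρ hM J).toTopRep)
          (κ.layerSubgroup_antitone hn) (κ.unitCoeffPkHom ρ hM J n h))) φ =
      contOneCocycles.pullback (ContinuousMonoidHom.id _)
        (resIdHom (κ.unitCoeffPkHom ρ hM J n' h')) φ :=
    Subtype.ext (ContinuousMap.ext fun g ↦ by
      rw [pullback_id_resIdHom_apply, pullback_id_resIdHom_apply, restrictHomOfLe_hom_apply,
        unitCoeffPkHom_hom_apply, unitCoeffPkHom_hom_apply])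
  rw [coresShapiroPk_apply, coresShapiroPk_apply, cohomologyMap_coresLe, cores_coresLe_eq_cores,
    cohomologyMap_oneCocycleClass, cohomologyMap_oneCocycleClass, hφ]

section ToModP

variable {M' : Type u} [AddCommGroup M'] [TopologicalSpace M'] [DiscreteTopology M']
  (ρ' : DiscreteGaloisModule K M') (hM' : ∀ x : M', p • x = 0)

/-- The `TopRep` morphism underlying a continuous equivariant map of discrete Galois modules
(plumbing for `cohomologyMap` / `subgroupRepHom`). [cite: SerreGaloisCohomology1997, I §2.2] -/
abbrev topRepHomOf (f : ρ.toContRepresentation →ⁱL ρ'.toContRepresentation) :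
    ρ.toTopRep ⟶ ρ'.toTopRep :=
  TopRep.ofHom ⟨f.toContinuousLinearMap, f.isIntertwining'⟩

/-- **Comparison with the mod-`p` model under a coefficient morphism.**  For a continuous equivariant
`f : M → M'` into a module killed by `p`, `J ≤ p^{n+1−k}` and `J ≤ p^n`:
`H¹(twistModPkToModP f) (coresShapiroPk n J c) = trunc_{J ← p^n} (coresShapiro n (H¹(f|_{Γ_n}) c))` in
`H¹(K, 𝒯_J(M'))` — both sides are `cor_{Γ_n}` of the class of `u ↦ f(φ(u)) · T⁰ ∈ 𝒯_J(M')` (naturality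
of `cores` in the coefficients, twice).  This is the levelwise form of "reduction mod `p` of the
level-`p^k` `Ω`-adic class is the mod-`p` one". [cite: SerreGaloisCohomology1997, I §2.5 (b)]
[cite: Kato2004Asterisque, §13.8 (p. 228)] -/
theorem map_toModP_coresShapiroPk (f : ρ.toContRepresentation →ⁱL ρ'.toContRepresentation)
    (h : J ≤ p ^ (n + 1 - k)) (hJn : J ≤ p ^ n) [Fintype (absoluteGaloisGroup K ⧸ κ.layerSubgroup n)]
    (c : continuousCohomology 1 (subgroupRep ρ.toTopRep (κ.layerSubgroup n))) :
    galoisCohomology.map (κ.twistModPkToModP ρ hM J ρ' hM' f) 1 (κ.coresShapiroPk ρ hM J n h c) =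
      κ.truncH1 ρ' hM' hJn (κ.coresShapiro ρ' hM' n
        (cohomologyMap (subgroupRepHom (topRepHomOf ρ ρ' f) (κ.layerSubgroup n)) 1 c)) := by
  rw [coresShapiroPk_apply, galoisCohomology.map_eq_cohomologyMap_apply,
    cohomologyMap_cores _ (κ.layerSubgroup n) (κ.isOpen_layerSubgroup n), truncH1,
    galoisCohomology.map_eq_cohomologyMap_apply]
  change _ = (cohomologyMap _ 1).hom (cores _ _ _ (cohomologyMap (κ.unitCoeffHom ρ' hM' n) 1 _))
  rw [cohomologyMap_cores _ (κ.layerSubgroup n) (κ.isOpen_layerSubgroup n)]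
  congr 1
  obtain ⟨φ, rfl⟩ := oneCocycleClass_surjective _ c
  simp only [cohomologyMap_oneCocycleClass]
  refine congrArg _ (Subtype.ext (ContinuousMap.ext fun g ↦ ?_))
  change (fun i => f (unitCoeffPk J (φ.1 g) i)) =
    κ.twistModPTruncate ρ' hM' (p ^ n) hJn (unitCoeff n (f (φ.1 g)))
  rw [map_unitCoeffPk_apply, ← unitCoeffPk_pow_eq_unitCoeff]
  exact (unitCoeffPk_castLE (p ^ n) hJn _).symm

/-! ## §4 The tower map along a coefficient morphism into the mod-`p` model -/

/-- Truncation commutes with `H¹` of a coefficient morphism into the mod-`p` model: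
`trunc ∘ H¹(f_*) = H¹(f_*) ∘ trunc` (both are induced by `x ↦ f ∘ (x mod T^{J'})`).
[cite: SerreGaloisCohomology1997, I §2.2] -/
theorem truncH1_map_toModP (f : ρ.toContRepresentation →ⁱL ρ'.toContRepresentation)
    {J' : ℕ} (hJ' : J' ≤ J) (c : galoisCohomology (κ.twistModPk ρ hM J) 1) :
    κ.truncH1 ρ' hM' hJ' (galoisCohomology.map (κ.twistModPkToModP ρ hM J ρ' hM' f) 1 c) =
      galoisCohomology.map (κ.twistModPkToModP ρ hM J' ρ' hM' f) 1 (κ.truncH1Pk ρ hM hJ' c) := by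
  unfold truncH1 truncH1Pk
  rw [galoisCohomology.map_map_of_comp_apply _ _
      ((κ.twistModPTruncate ρ' hM' J hJ').comp (κ.twistModPkToModP ρ hM J ρ' hM' f)) (fun _ => rfl),
    galoisCohomology.map_map_of_comp_apply _ _
      ((κ.twistModPkToModP ρ hM J' ρ' hM' f).comp (κ.twistModPkTruncate ρ hM J hJ')) (fun _ => rfl)]
  exact galoisCohomology.map_congr_apply _ _ (fun x => rfl) c

/-- **The map of towers `lim← H¹(K, 𝒯_J^{(k)}(M)) → lim← H¹(K, 𝒯_J(M'))` along a coefficient morphism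
`f : M → M'` into the mod-`p` model** (levelwise `H¹(twistModPkToModP f)`, compatible with truncation
by `truncH1_map_toModP`); e.g. along `p^{k−1}• : E[p^k] → E[p]`, the reduction of the level-`p^k`
`Ω`-adic tower to the mod-`p` one of `IwasawaTwistModPTower`. [cite: MazurRubin2004, §5.3] -/
def twistTowerPkToModP (f : ρ.toContRepresentation →ⁱL ρ'.toContRepresentation) :
    κ.twistTowerPk ρ hM →+ κ.twistTower ρ' hM' where
  toFun x := ⟨fun J => galoisCohomology.map (κ.twistModPkToModP ρ hM J ρ' hM' f) 1 (x.1 J),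
    fun J J' h => by rw [truncH1_map_toModP, x.2 J J' h]⟩
  map_zero' := Subtype.ext (funext fun J => by
    change galoisCohomology.map _ 1 ((0 : κ.twistTowerPk ρ hM).1 J) = 0
    rw [ZeroMemClass.coe_zero, Pi.zero_apply, map_zero])
  map_add' x y := Subtype.ext (funext fun J => by
    change galoisCohomology.map _ 1 ((x + y).1 J) =
      galoisCohomology.map _ 1 (x.1 J) + galoisCohomology.map _ 1 (y.1 J)
    rw [AddMemClass.coe_add, Pi.add_apply, map_add])

/-- Components of `twistTowerPkToModP`. [cite: MazurRubin2004, §5.3] -/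
@[simp] theorem twistTowerPkToModP_apply_coe (f : ρ.toContRepresentation →ⁱL ρ'.toContRepresentation)
    (x : κ.twistTowerPk ρ hM) (J : ℕ) :
    (κ.twistTowerPkToModP ρ hM ρ' hM' f x).1 J =
      galoisCohomology.map (κ.twistModPkToModP ρ hM J ρ' hM' f) 1 (x.1 J) := rfl

end ToModP

end ZpExtension

end Literature.NumberTheory.EllipticCurves

end
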